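import Literature.Computability.AlgebraicComplexity.QuantumFunctionalsSpectrumEstimation
import HarnessLib

/-!
# `E^θ = E_θ` (CVZ Thm. 3.30): the entanglement-polytope direction `E^θ ≤ E_θ` and the discharge
# of `ChristandlVranaZuiddam2023_upper_eq_lower`

Topic `Literature/Computability/AlgebraicComplexity`; proofs file (theorems only) for
M. Christandl, P. Vrana, J. Zuiddam, *Universal points in the asymptotic spectrum of tensors*,
J. Amer. Math. Soc. 36 (2023) 31–79 = arXiv:1709.07851v3, **Theorem 3.30** (`E^θ(t) = E_θ(t)` for
`θ ∈ P_s(B)`, which for `k = 3` is all of `P([3])`), i.e. the named fact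
`ChristandlVranaZuiddam2023_upper_eq_lower` of `QuantumFunctionalsUpper.lean`. The direction
`E_θ ≤ E^θ` (Thm. 3.24) is `logQuantumFunctional_le_upperLogQuantumFunctional`
(`QuantumFunctionalsSpectrumEstimation.lean`). This file proves the other direction,
`E^θ ≤ E_θ`, whose printed proof is the entanglement-polytope characterisation Thm. 3.29
(Ness–Mumford [NM84], Brion [Bri87], Walter–Doran–Gross–Christandl): an admissible triple
`(λ, μ, ν)`, `(P_λ ⊗ P_μ ⊗ P_ν) t^{⊗n} ≠ 0`, yields a highest-weight covariant of weight `(λ, μ, ν)`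
not vanishing on the orbit of `t`, hence a unit vector in the orbit closure with marginal spectra
`(λ̄, μ̄, ν̄)`, hence `∑ θⱼ H(λ̄⁽ʲ⁾) ≤ E_θ(t)`. All ingredients are in the tree:

* the analytic Ness–Mumford step for 3-tensors:
  `IsLowerSemiInvariant.weightedEntropy_le_logQuantumFunctional_of_orbit`
  (`QuantumFunctionalsSemiInvariant.lean`);
* Schur–Weyl duality in span form: the range of `P_λ` on `(ℂ^N)^{⊗n}` is spanned by the
  `GL_N`-translates of the highest-weight vectors of weight `λ` (`range_isotypicProj_wordPermRep`,
  `WordModelIsotypicSpan.lean`), and the bridge `isotypicSumⱼ ∝ P_λ` (`QuantumFunctionalsUpperBridge.lean`).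

What is proved here is the glue (§§1–4) and the assembly (§5):

1. the bilinear pairing `⟪Y, T⟫ = ∑ Y T` of 3-leg tensors and its adjunction
   `⟪Y, (A ⊗ B ⊗ C)·T⟫ = ⟪(Aᵀ ⊗ Bᵀ ⊗ Cᵀ)·Y, T⟫`; `P_λᵀ = P_λ`, `(g^{⊗n})ᵀ = (gᵀ)^{⊗n}`;
2. triads of vectors from three spans lie in the span of the triads of generators;
3. `(P_λ ⊗ P_μ ⊗ P_ν) Y ≠ 0` ⇒ `⟪Y, g₁^{⊗n}ξ₁ ⊗ g₂^{⊗n}ξ₂ ⊗ g₃^{⊗n}ξ₃⟫ ≠ 0` for some `gⱼ ∈ GL` and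
   highest-weight vectors `ξⱼ` (`exists_pairing_triad_ne_zero`);
4. `f(y) = ⟪y^{⊗n}, ξ₁ ⊗ ξ₂ ⊗ ξ₃⟫` is a continuous lower-Borel semi-invariant of weight
   `(λ, μ, ν)` (as letter contents) and degree `n`, with `f(gᵀ·x) ≠ 0`;
5. `weightedPartitionEntropy θ λ ≤ E_θ(x)` for every admissible triple (legs with `θⱼ = 0` are first
   completed using `∑_ν P_ν = 1`), hence `E^θ(x) ≤ E_θ(x)` on alphabets `Fin a`, then on arbitrary
   finite index types by relabelling, and `ChristandlVranaZuiddam2023_upper_eq_lower_holds`.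

No definitions, no named facts.

## References

* M. Christandl, P. Vrana, J. Zuiddam, J. Amer. Math. Soc. 36 (2023) 31–79 = arXiv:1709.07851v3,
  §3.1 (sw), Def. 3.3, Def. 3.16, Lemma 3.20, §3.4 (Thm. 3.29, Thm. 3.30). [ChristandlVranaZuiddam2023]
* L. Ness (appendix by D. Mumford), Amer. J. Math. 106 (1984) 1281–1329; M. Brion, LNM 1296 (1987);
  M. Walter, B. Doran, D. Gross, M. Christandl, Science 340 (2013) — as cited in the source for Thm. 3.29.
* W. Fulton, J. Harris, *Representation Theory*, GTM 129, Thm. 6.3, §15.5. [FultonHarrisGTM129]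
-/

noncomputable section

open scoped BigOperators Matrix ComplexOrder Kronecker

namespace Literature.Computability.AlgebraicComplexity

open Literature.NumberTheory.DiophantineGeometry (Word wordRep wordRep_apply wordPermRep
  tensorPowerMatrix spechtCharacter spechtCharacter_inv highestWeightSpace Weight weightChar
  IsUpperTriangular mem_highestWeightSpace_iff)
open Literature.RepresentationTheory.FiniteGroups (wordIsotypicMatrix wordIsotypicMatrix_apply
  wordIsotypicMatrix_mulVec wordIsotypicProj isotypicProj sum_wordIsotypicMatrix)
open Literature.RepresentationTheory.GeneralLinear (range_isotypicProj_wordPermRep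
  highestWeightSpace_ofPartition_eq_bot_of_lt)

/-! ## §1 The bilinear pairing of 3-leg tensors -/

section Pairing

variable {α β γ : Type*} [Fintype α] [Fintype β] [Fintype γ]

/-- The bilinear pairing `∑ Y T` of two 3-leg tensors as a dot product of their vectorisations.
[folklore] -/
theorem sum_mul_eq_vec_dotProduct_vec (Y T : α → β → γ → ℂ) :
    ∑ u, ∑ v, ∑ w, Y u v w * T u v w =
      (fun p : α × β × γ => Y p.1 p.2.1 p.2.2) ⬝ᵥ (fun p : α × β × γ => T p.1 p.2.1 p.2.2) := by
  simp only [dotProduct, Fintype.sum_prod_type]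

/-- **Adjunction for the bilinear pairing**: `⟪Y, (A ⊗ B ⊗ C)·T⟫ = ⟪(Aᵀ ⊗ Bᵀ ⊗ Cᵀ)·Y, T⟫`.
[folklore] -/
theorem sum_mul_actTensor (Y T : α → β → γ → ℂ) (A : Matrix α α ℂ) (B : Matrix β β ℂ)
    (C : Matrix γ γ ℂ) :
    ∑ u, ∑ v, ∑ w, Y u v w * actTensor A B C T u v w =
      ∑ u, ∑ v, ∑ w, actTensor Aᵀ Bᵀ Cᵀ Y u v w * T u v w := by
  rw [sum_mul_eq_vec_dotProduct_vec, sum_mul_eq_vec_dotProduct_vec, vec_actTensor, vec_actTensor,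
    Matrix.dotProduct_mulVec, ← Matrix.mulVec_transpose, ← Matrix.kroneckerMap_transpose,
    ← Matrix.kroneckerMap_transpose]

/-- The pairing is linear in the second argument: scalars. [folklore] -/
theorem sum_mul_smul (Y T : α → β → γ → ℂ) (z : ℂ) :
    ∑ u, ∑ v, ∑ w, Y u v w * (z • T) u v w = z * ∑ u, ∑ v, ∑ w, Y u v w * T u v w := by
  simp only [Pi.smul_apply, smul_eq_mul, Finset.mul_sum]
  exact Finset.sum_congr rfl fun _ _ => Finset.sum_congr rfl fun _ _ =>
    Finset.sum_congr rfl fun _ _ => by ring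

/-- **A linear functional vanishing on generators vanishes on their span** (for the pairing
`⟪Y, ·⟫`). [folklore] -/
theorem sum_mul_eq_zero_of_mem_span {G : Set (α → β → γ → ℂ)} {Y : α → β → γ → ℂ}
    (hG : ∀ T ∈ G, ∑ u, ∑ v, ∑ w, Y u v w * T u v w = 0) {T : α → β → γ → ℂ}
    (hT : T ∈ Submodule.span ℂ G) : ∑ u, ∑ v, ∑ w, Y u v w * T u v w = 0 := by
  induction hT using Submodule.span_induction with
  | mem x hx => exact hG x hx
  | zero => simp
  | add x y _ _ hx hy => simp only [Pi.add_apply, mul_add, Finset.sum_add_distrib, hx, hy, add_zero]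
  | smul r x _ hx => rw [sum_mul_smul, hx, mul_zero]

end Pairing

/-! ## §1' Transposes of the projectors and of Kronecker powers -/

section Transposes

variable {N n : ℕ}

/-- **`P_λᵀ = P_λ`** (the coefficients satisfy `χ_λ(t⁻¹) = χ_λ(t)`). [folklore] -/
theorem transpose_wordIsotypicMatrix (lam : Nat.Partition n) :
    (wordIsotypicMatrix N n lam)ᵀ = wordIsotypicMatrix N n lam := by
  ext w' w
  rw [Matrix.transpose_apply, wordIsotypicMatrix_apply, wordIsotypicMatrix_apply]
  refine Fintype.sum_equiv (Equiv.inv (Equiv.Perm (Fin n))) _ _ fun t => ?_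
  simp only [Equiv.inv_apply, inv_inv, spechtCharacter_inv]
  have hiff : w' = w ∘ ⇑t⁻¹ ↔ w = w' ∘ ⇑t := by
    constructor
    · intro h; rw [h]; funext p; simp
    · intro h; rw [h]; funext p; simp
  by_cases h : w' = w ∘ ⇑t⁻¹
  · rw [if_pos h, if_pos (hiff.1 h)]
  · rw [if_neg h, if_neg (fun e => h (hiff.2 e))]

/-- `(A^{⊗n})ᵀ = (Aᵀ)^{⊗n}`. [folklore] -/
theorem transpose_powMat {ι : Type*} (A : Matrix ι ι ℂ) (n : ℕ) : (powMat A n)ᵀ = powMat Aᵀ n := by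
  ext u u'
  simp only [Matrix.transpose_apply, powMat_apply]

end Transposes

/-! ## §2 Triads from spans -/

section TriadSpan

variable {α β γ : Type*}

/-- `triad` is additive in the first vector. [folklore] -/
theorem triad_add_fst (a a' : α → ℂ) (b : β → ℂ) (c : γ → ℂ) :
    triad (a + a') b c = triad a b c + triad a' b c := by
  funext u v w; simp only [triad, Pi.add_apply]; ring

/-- `triad` is additive in the second vector. [folklore] -/
theorem triad_add_snd (a : α → ℂ) (b b' : β → ℂ) (c : γ → ℂ) :
    triad a (b + b') c = triad a b c + triad a b' c := by
  funext u v w; simp only [triad, Pi.add_apply]; ring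

/-- `triad` is additive in the third vector. [folklore] -/
theorem triad_add_thd (a : α → ℂ) (b : β → ℂ) (c c' : γ → ℂ) :
    triad a b (c + c') = triad a b c + triad a b c' := by
  funext u v w; simp only [triad, Pi.add_apply]; ring

/-- `triad` is homogeneous in the first vector. [folklore] -/
theorem triad_smul_fst (z : ℂ) (a : α → ℂ) (b : β → ℂ) (c : γ → ℂ) :
    triad (z • a) b c = z • triad a b c := by
  funext u v w; simp only [triad, Pi.smul_apply, smul_eq_mul]; ring

/-- `triad` is homogeneous in the second vector. [folklore] -/
theorem triad_smul_snd (z : ℂ) (a : α → ℂ) (b : β → ℂ) (c : γ → ℂ) :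
    triad a (z • b) c = z • triad a b c := by
  funext u v w; simp only [triad, Pi.smul_apply, smul_eq_mul]; ring

/-- `triad` is homogeneous in the third vector. [folklore] -/
theorem triad_smul_thd (z : ℂ) (a : α → ℂ) (b : β → ℂ) (c : γ → ℂ) :
    triad a b (z • c) = z • triad a b c := by
  funext u v w; simp only [triad, Pi.smul_apply, smul_eq_mul]; ring

/-- `triad` vanishes when a vector does. [folklore] -/
@[simp] theorem triad_zero_fst (b : β → ℂ) (c : γ → ℂ) : triad (0 : α → ℂ) b c = 0 := by
  funext u v w; simp [triad]

/-- `triad` vanishes when a vector does. [folklore] -/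
@[simp] theorem triad_zero_snd (a : α → ℂ) (c : γ → ℂ) : triad a (0 : β → ℂ) c = 0 := by
  funext u v w; simp [triad]

/-- `triad` vanishes when a vector does. [folklore] -/
@[simp] theorem triad_zero_thd (a : α → ℂ) (b : β → ℂ) : triad a b (0 : γ → ℂ) = 0 := by
  funext u v w; simp [triad]

/-- **Triads of vectors taken from three spans lie in the span of the triads of generators**
(trilinearity of `w ⊗ u ⊗ v`). [folklore] -/
theorem triad_mem_span {G₁ : Set (α → ℂ)} {G₂ : Set (β → ℂ)} {G₃ : Set (γ → ℂ)} {a : α → ℂ}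
    {b : β → ℂ} {c : γ → ℂ} (ha : a ∈ Submodule.span ℂ G₁) (hb : b ∈ Submodule.span ℂ G₂)
    (hc : c ∈ Submodule.span ℂ G₃) :
    triad a b c ∈ Submodule.span ℂ
      {T : α → β → γ → ℂ | ∃ x ∈ G₁, ∃ y ∈ G₂, ∃ z ∈ G₃, T = triad x y z} := by
  set S := Submodule.span ℂ {T : α → β → γ → ℂ | ∃ x ∈ G₁, ∃ y ∈ G₂, ∃ z ∈ G₃, T = triad x y z}
    with hS
  -- generators first
  have h3 : ∀ x ∈ G₁, ∀ y ∈ G₂, ∀ {c}, c ∈ Submodule.span ℂ G₃ → triad x y c ∈ S := by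
    intro x hx y hy c hc
    refine Submodule.span_induction (p := fun c _ => triad x y c ∈ S) ?_ ?_ ?_ ?_ hc
    · intro z hz
      exact Submodule.subset_span ⟨x, hx, y, hy, z, hz, rfl⟩
    · rw [triad_zero_thd]; exact Submodule.zero_mem _
    · intro c c' _ _ h h'
      rw [triad_add_thd]; exact Submodule.add_mem _ h h'
    · intro r c _ h
      rw [triad_smul_thd]; exact Submodule.smul_mem _ r h
  have h2 : ∀ x ∈ G₁, ∀ {b}, b ∈ Submodule.span ℂ G₂ → ∀ {c}, c ∈ Submodule.span ℂ G₃ →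
      triad x b c ∈ S := by
    intro x hx b hb
    refine Submodule.span_induction
      (p := fun b _ => ∀ {c}, c ∈ Submodule.span ℂ G₃ → triad x b c ∈ S) ?_ ?_ ?_ ?_ hb
    · intro y hy c hc
      exact h3 x hx y hy hc
    · intro c _
      rw [triad_zero_snd]; exact Submodule.zero_mem _
    · intro b b' _ _ h h' c hc
      rw [triad_add_snd]; exact Submodule.add_mem _ (h hc) (h' hc)
    · intro r b _ h c hc
      rw [triad_smul_snd]; exact Submodule.smul_mem _ r (h hc)
  refine Submodule.span_induction
    (p := fun a _ => ∀ {b}, b ∈ Submodule.span ℂ G₂ → ∀ {c}, c ∈ Submodule.span ℂ G₃ →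
      triad a b c ∈ S) ?_ ?_ ?_ ?_ ha hb hc
  · intro x hx b hb c hc
    exact h2 x hx hb hc
  · intro b _ c _
    rw [triad_zero_fst]; exact Submodule.zero_mem _
  · intro a a' _ _ h h' b hb c hc
    rw [triad_add_fst]; exact Submodule.add_mem _ (h hb hc) (h' hb hc)
  · intro r a _ h b hb c hc
    rw [triad_smul_fst]; exact Submodule.smul_mem _ r (h hb hc)

end TriadSpan

/-! ## §3 From a non-vanishing isotypic projection to a non-vanishing pairing with a triad of
translated highest-weight vectors -/

section Generators

variable {a b c n : ℕ}

/-- A 3-leg tensor acted on by three matrices is a combination of triads of their columns.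
[folklore] -/
theorem actTensor_eq_sum_triad_col {α β γ α' β' γ' : Type*} [Fintype α] [Fintype β] [Fintype γ]
    (A : Matrix α' α ℂ) (B : Matrix β' β ℂ) (C : Matrix γ' γ ℂ) (T : α → β → γ → ℂ) :
    actTensor A B C T = ∑ u, ∑ v, ∑ w,
      T u v w • triad (fun u' => A u' u) (fun v' => B v' v) (fun w' => C w' w) := by
  funext u' v' w'
  simp only [actTensor_apply, Finset.sum_apply, Pi.smul_apply, smul_eq_mul, triad]
  exact Finset.sum_congr rfl fun _ _ => Finset.sum_congr rfl fun _ _ =>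
    Finset.sum_congr rfl fun _ _ => by ring

/-- The columns of `P_λ` lie in the span of the `GL`-translates of `HW_λ`. [cite: FultonHarrisGTM129, Thm. 6.3] -/
theorem col_wordIsotypicMatrix_mem_span (lam : Nat.Partition n) (u : Word a n) :
    (fun u' => wordIsotypicMatrix a n lam u' u) ∈ Submodule.span ℂ (Set.range
      fun p : GL (Fin a) ℂ × highestWeightSpace (wordRep ℂ a n) (Weight.ofPartition a lam) =>
        wordRep ℂ a n p.1 (p.2 : Word a n → ℂ)) := by
  have hcol : (fun u' => wordIsotypicMatrix a n lam u' u) =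
      wordIsotypicMatrix a n lam *ᵥ Pi.single u 1 := by
    funext u'
    simp [Matrix.mulVec, dotProduct, Pi.single_apply]
  rw [hcol, wordIsotypicMatrix_mulVec, ← range_isotypicProj_wordPermRep]
  exact ⟨_, rfl⟩

/-- **From `(P_λ ⊗ P_μ ⊗ P_ν) Y ≠ 0` to a non-vanishing pairing with a triad of translated
highest-weight vectors**: there are `gⱼ ∈ GL` and highest-weight vectors `ξⱼ` of weights `λ, μ, ν`
in the three word models with `⟪Y, g₁^{⊗n}ξ₁ ⊗ g₂^{⊗n}ξ₂ ⊗ g₃^{⊗n}ξ₃⟫ ≠ 0` (Schur–Weyl duality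
in span form, `range_isotypicProj_wordPermRep`). [cite: ChristandlVranaZuiddam2023, Thm. 3.29] -/
theorem exists_pairing_triad_ne_zero {lam mu nu : Nat.Partition n}
    {Y : Word a n → Word b n → Word c n → ℂ}
    (h : actTensor (wordIsotypicMatrix a n lam) (wordIsotypicMatrix b n mu)
      (wordIsotypicMatrix c n nu) Y ≠ 0) :
    ∃ (g₁ : GL (Fin a) ℂ) (g₂ : GL (Fin b) ℂ) (g₃ : GL (Fin c) ℂ) (ξ₁ : Word a n → ℂ)
      (ξ₂ : Word b n → ℂ) (ξ₃ : Word c n → ℂ),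
      ξ₁ ∈ highestWeightSpace (wordRep ℂ a n) (Weight.ofPartition a lam) ∧
      ξ₂ ∈ highestWeightSpace (wordRep ℂ b n) (Weight.ofPartition b mu) ∧
      ξ₃ ∈ highestWeightSpace (wordRep ℂ c n) (Weight.ofPartition c nu) ∧
      ∑ u, ∑ v, ∑ w, Y u v w *
        triad (wordRep ℂ a n g₁ ξ₁) (wordRep ℂ b n g₂ ξ₂) (wordRep ℂ c n g₃ ξ₃) u v w ≠ 0 := by
  classical
  -- `⟪Z, Z̄⟫ = ‖Z‖² ≠ 0` for `Z = (P ⊗ P ⊗ P) Y`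
  have hZZ : ∑ u, ∑ v, ∑ w,
      actTensor (wordIsotypicMatrix a n lam) (wordIsotypicMatrix b n mu) (wordIsotypicMatrix c n nu) Y
        u v w * star (actTensor (wordIsotypicMatrix a n lam) (wordIsotypicMatrix b n mu)
          (wordIsotypicMatrix c n nu) Y u v w) ≠ 0 := by
    rw [Ne, ← tensorNormSq_eq_zero_iff] at h
    intro h0
    apply h
    have hre : ∀ Z : Word a n → Word b n → Word c n → ℂ,
        (∑ u, ∑ v, ∑ w, Z u v w * star (Z u v w)) = ((tensorNormSq Z : ℝ) : ℂ) := by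
      intro Z
      simp only [tensorNormSq, Complex.ofReal_sum]
      refine Finset.sum_congr rfl fun u _ => Finset.sum_congr rfl fun v _ =>
        Finset.sum_congr rfl fun w _ => ?_
      rw [Complex.star_def, Complex.mul_conj, Complex.normSq_eq_norm_sq, Complex.ofReal_pow]
    rw [hre] at h0
    exact_mod_cast h0
  -- `⟪Z, Z̄⟫ = ⟪Y, (P ⊗ P ⊗ P) Z̄⟫`
  have hZZ' : ∑ u, ∑ v, ∑ w, Y u v w * actTensor (wordIsotypicMatrix a n lam)
      (wordIsotypicMatrix b n mu) (wordIsotypicMatrix c n nu)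
      (star (actTensor (wordIsotypicMatrix a n lam) (wordIsotypicMatrix b n mu)
        (wordIsotypicMatrix c n nu) Y)) u v w ≠ 0 := by
    rw [sum_mul_actTensor, transpose_wordIsotypicMatrix, transpose_wordIsotypicMatrix,
      transpose_wordIsotypicMatrix]
    exact hZZ
  -- `(P ⊗ P ⊗ P) Z̄` lies in the span of the triads of generators
  have hR : actTensor (wordIsotypicMatrix a n lam) (wordIsotypicMatrix b n mu)
      (wordIsotypicMatrix c n nu) (star (actTensor (wordIsotypicMatrix a n lam)
        (wordIsotypicMatrix b n mu) (wordIsotypicMatrix c n nu) Y)) ∈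
      Submodule.span ℂ {T : Word a n → Word b n → Word c n → ℂ |
        ∃ x ∈ Set.range (fun p : GL (Fin a) ℂ × highestWeightSpace (wordRep ℂ a n)
            (Weight.ofPartition a lam) => wordRep ℂ a n p.1 (p.2 : Word a n → ℂ)),
        ∃ y ∈ Set.range (fun p : GL (Fin b) ℂ × highestWeightSpace (wordRep ℂ b n)
            (Weight.ofPartition b mu) => wordRep ℂ b n p.1 (p.2 : Word b n → ℂ)),
        ∃ z ∈ Set.range (fun p : GL (Fin c) ℂ × highestWeightSpace (wordRep ℂ c n)
            (Weight.ofPartition c nu) => wordRep ℂ c n p.1 (p.2 : Word c n → ℂ)),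
        T = triad x y z} := by
    rw [actTensor_eq_sum_triad_col]
    refine Submodule.sum_mem _ fun u _ => Submodule.sum_mem _ fun v _ =>
      Submodule.sum_mem _ fun w _ => Submodule.smul_mem _ _ ?_
    exact triad_mem_span (col_wordIsotypicMatrix_mem_span lam u)
      (col_wordIsotypicMatrix_mem_span mu v) (col_wordIsotypicMatrix_mem_span nu w)
  -- so the functional `⟪Y, ·⟫` does not vanish on some generator
  by_contra hall
  push Not at hall
  refine hZZ' (sum_mul_eq_zero_of_mem_span ?_ hR)
  rintro _ ⟨_, ⟨⟨g₁, ξ₁⟩, rfl⟩, _, ⟨⟨g₂, ξ₂⟩, rfl⟩, _, ⟨⟨g₃, ξ₃⟩, rfl⟩, rfl⟩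
  exact hall g₁ g₂ g₃ ξ₁ ξ₂ ξ₃ ξ₁.2 ξ₂.2 ξ₃.2

end Generators

/-! ## §4 The covariant `f(y) = ⟪y^{⊗n}, ξ₁ ⊗ ξ₂ ⊗ ξ₃⟫` is a lower semi-invariant -/

section Covariant

variable {a b c n : ℕ}

/-- A lower triangular matrix with nonzero diagonal is invertible. [folklore] -/
theorem det_ne_zero_of_lowerTriangular {N : ℕ} {A : Matrix (Fin N) (Fin N) ℂ}
    (hA : A.BlockTriangular OrderDual.toDual) (hAd : ∀ i, A i i ≠ 0) : A.det ≠ 0 := by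
  rw [Matrix.det_of_lowerTriangular A hA]
  exact Finset.prod_ne_zero_iff.2 fun i _ => hAd i

/-- The transpose of an invertible lower triangular matrix, as an element of `GL`, is upper
triangular. [folklore] -/
theorem isUpperTriangular_transpose {N : ℕ} {A : Matrix (Fin N) (Fin N) ℂ}
    (hA : A.BlockTriangular OrderDual.toDual) (hdet : Aᵀ.det ≠ 0) :
    IsUpperTriangular (Matrix.GeneralLinearGroup.mkOfDetNeZero Aᵀ hdet) := by
  show (Aᵀ).BlockTriangular id
  exact hA.transpose

/-- **Highest-weight vectors transform under `(Aᵀ)^{⊗n}` by the character**: for a lower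
triangular `A` with nonzero diagonal and `ξ ∈ HW_λ`,
`(Aᵀ)^{⊗n} ξ = (∏ᵢ A_{ii}^{λᵢ}) ξ`. [cite: FultonHarrisGTM129, §15.5] -/
theorem powMat_transpose_mulVec_of_mem_highestWeightSpace {N : ℕ} {lam : Nat.Partition n}
    {ξ : Word N n → ℂ} (hξ : ξ ∈ highestWeightSpace (wordRep ℂ N n) (Weight.ofPartition N lam))
    {A : Matrix (Fin N) (Fin N) ℂ} (hA : A.BlockTriangular OrderDual.toDual) (hAd : ∀ i, A i i ≠ 0) :
    powMat Aᵀ n *ᵥ ξ = (∏ i, A i i ^ lam.sortedParts.getD i 0) • ξ := by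
  have hdet : Aᵀ.det ≠ 0 := by rw [Matrix.det_transpose]; exact det_ne_zero_of_lowerTriangular hA hAd
  set g := Matrix.GeneralLinearGroup.mkOfDetNeZero Aᵀ hdet with hg
  have hξg := (mem_highestWeightSpace_iff _ _ _).1 hξ g (isUpperTriangular_transpose hA hdet)
  rw [wordRep_eq_powMat_mulVec] at hξg
  have hcoe : (g : Matrix (Fin N) (Fin N) ℂ) = Aᵀ := rfl
  rw [hcoe] at hξg
  rw [hξg]
  rfl

variable (n) in
/-- The covariant attached to three vectors: `f(y) = ⟪y^{⊗n}, ξ₁ ⊗ ξ₂ ⊗ ξ₃⟫` is continuous.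
[folklore] -/
theorem continuous_pairing_kroneckerPow (ξ₁ : Word a n → ℂ) (ξ₂ : Word b n → ℂ) (ξ₃ : Word c n → ℂ) :
    Continuous fun y : Fin a → Fin b → Fin c → ℂ =>
      ∑ u, ∑ v, ∑ w, kroneckerPow y n u v w * triad ξ₁ ξ₂ ξ₃ u v w := by
  refine continuous_finsetSum _ fun u _ => continuous_finsetSum _ fun v _ =>
    continuous_finsetSum _ fun w _ => ?_
  refine Continuous.mul ?_ continuous_const
  exact ((continuous_apply w).comp ((continuous_apply v).comp
    ((continuous_apply u).comp (continuous_kroneckerPow n))))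

/-- **The covariant is a lower-Borel semi-invariant of weight `(λ, μ, ν)`** (as letter contents):
`f((A ⊗ B ⊗ C)·y) = (∏ A_{ii}^{λᵢ})(∏ B_{jj}^{μⱼ})(∏ C_{kk}^{ν_k}) f(y)` for lower triangular
`A, B, C` with nonzero diagonals, when `ξ₁, ξ₂, ξ₃` are highest-weight vectors of weights `λ, μ, ν`
(`⟪(A·y)^{⊗n}, Ξ⟫ = ⟪y^{⊗n}, ((Aᵀ)^{⊗n} ⊗ (Bᵀ)^{⊗n} ⊗ (Cᵀ)^{⊗n}) Ξ⟫`).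
[cite: ChristandlVranaZuiddam2023, Thm. 3.29] -/
theorem isLowerSemiInvariant_pairing_kroneckerPow {lam mu nu : Nat.Partition n}
    {ξ₁ : Word a n → ℂ} {ξ₂ : Word b n → ℂ} {ξ₃ : Word c n → ℂ}
    (h₁ : ξ₁ ∈ highestWeightSpace (wordRep ℂ a n) (Weight.ofPartition a lam))
    (h₂ : ξ₂ ∈ highestWeightSpace (wordRep ℂ b n) (Weight.ofPartition b mu))
    (h₃ : ξ₃ ∈ highestWeightSpace (wordRep ℂ c n) (Weight.ofPartition c nu)) :
    IsLowerSemiInvariant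
      (fun y : Fin a → Fin b → Fin c → ℂ => ∑ u, ∑ v, ∑ w, kroneckerPow y n u v w * triad ξ₁ ξ₂ ξ₃ u v w)
      (fun i => lam.sortedParts.getD i 0) (fun j => mu.sortedParts.getD j 0)
      (fun k => nu.sortedParts.getD k 0) := by
  intro A B C hA hB hC hAd hBd hCd y
  simp only []
  rw [kroneckerPow_actTensor_powMat]
  -- move the Kronecker powers to the triad
  have hadj : ∑ u, ∑ v, ∑ w, actTensor (powMat A n) (powMat B n) (powMat C n) (kroneckerPow y n) u v w *
      triad ξ₁ ξ₂ ξ₃ u v w = ∑ u, ∑ v, ∑ w, kroneckerPow y n u v w *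
        actTensor (powMat A n)ᵀ (powMat B n)ᵀ (powMat C n)ᵀ (triad ξ₁ ξ₂ ξ₃) u v w := by
    rw [sum_mul_actTensor, Matrix.transpose_transpose, Matrix.transpose_transpose,
      Matrix.transpose_transpose]
  rw [hadj, transpose_powMat, transpose_powMat, transpose_powMat, actTensor_triad,
    powMat_transpose_mulVec_of_mem_highestWeightSpace h₁ hA hAd,
    powMat_transpose_mulVec_of_mem_highestWeightSpace h₂ hB hBd,
    powMat_transpose_mulVec_of_mem_highestWeightSpace h₃ hC hCd, triad_smul_fst, triad_smul_snd,
    triad_smul_thd, sum_mul_smul, sum_mul_smul, sum_mul_smul]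
  ring

/-- The pairing with a triad of translated vectors is the covariant at the transposed group
element: `⟪x^{⊗n}, g₁^{⊗n}ξ₁ ⊗ g₂^{⊗n}ξ₂ ⊗ g₃^{⊗n}ξ₃⟫ = f((g₁ᵀ ⊗ g₂ᵀ ⊗ g₃ᵀ)·x)`. [folklore] -/
theorem pairing_triad_wordRep (x : Fin a → Fin b → Fin c → ℂ) (g₁ : GL (Fin a) ℂ) (g₂ : GL (Fin b) ℂ)
    (g₃ : GL (Fin c) ℂ) (ξ₁ : Word a n → ℂ) (ξ₂ : Word b n → ℂ) (ξ₃ : Word c n → ℂ) :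
    ∑ u, ∑ v, ∑ w, kroneckerPow x n u v w *
        triad (wordRep ℂ a n g₁ ξ₁) (wordRep ℂ b n g₂ ξ₂) (wordRep ℂ c n g₃ ξ₃) u v w =
      ∑ u, ∑ v, ∑ w, kroneckerPow (actTensor (g₁ : Matrix (Fin a) (Fin a) ℂ)ᵀ
        (g₂ : Matrix (Fin b) (Fin b) ℂ)ᵀ (g₃ : Matrix (Fin c) (Fin c) ℂ)ᵀ x) n u v w *
        triad ξ₁ ξ₂ ξ₃ u v w := by
  rw [wordRep_eq_powMat_mulVec, wordRep_eq_powMat_mulVec, wordRep_eq_powMat_mulVec, ← actTensor_triad,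
    sum_mul_actTensor, transpose_powMat, transpose_powMat, transpose_powMat,
    kroneckerPow_actTensor_powMat]

/-- The zero-padded parts of a partition with at most `N` parts sum to `n`. [folklore] -/
theorem sum_sortedParts_getD {N : ℕ} {lam : Nat.Partition n} (hN : lam.parts.card ≤ N) :
    ∑ i : Fin N, lam.sortedParts.getD i 0 = n := by
  have hlen : lam.sortedParts.length ≤ N := by rw [Nat.Partition.length_sortedParts]; exact hN
  have h := sum_sortedParts_getD_eq lam hlen (fun m : ℕ => (m : ℝ))
  simp only [Nat.cast_zero, mul_zero, add_zero] at h
  have hparts : (lam.parts.map (fun m : ℕ => (m : ℝ))).sum = (n : ℝ) := by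
    rw [← Nat.cast_multiset_sum, lam.parts_sum]
  rw [hparts, ← Nat.cast_sum] at h
  exact_mod_cast h

/-- The entropy of the zero-padded normalised parts is `H(λ̄)`. [folklore] -/
theorem shannonEntropy_sortedParts_getD {N : ℕ} {lam : Nat.Partition n} (hN : lam.parts.card ≤ N) :
    shannonEntropy (fun i : Fin N => (lam.sortedParts.getD i 0 : ℝ) / n) = partitionEntropy lam := by
  rw [shannonEntropy_def, partitionEntropy_def]
  congr 1
  have hlen : lam.sortedParts.length ≤ N := by rw [Nat.Partition.length_sortedParts]; exact hN
  have h := sum_sortedParts_getD_eq lam hlen (fun m : ℕ => Real.negMulLog ((m : ℝ) / n))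
  simp only [Nat.cast_zero, zero_div, Real.negMulLog_zero, mul_zero, add_zero] at h
  exact h

/-- A nonzero highest-weight vector of weight `λ` forces `λ` to have at most `N` parts.
[cite: FultonHarrisGTM129, Thm. 6.3 (1)] -/
theorem card_parts_le_of_mem_highestWeightSpace_ne_zero {N : ℕ} {lam : Nat.Partition n}
    {ξ : Word N n → ℂ} (hξ : ξ ∈ highestWeightSpace (wordRep ℂ N n) (Weight.ofPartition N lam))
    (hne : ξ ≠ 0) : lam.parts.card ≤ N := by
  by_contra h
  have hbot := highestWeightSpace_ofPartition_eq_bot_of_lt (n := n) (not_le.1 h)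
  rw [hbot, Submodule.mem_bot] at hξ
  exact hne hξ

/-- **`∑ θⱼ H(λ̄⁽ʲ⁾) ≤ E_θ(x)` for a triple of isotypic projectors not killing `x^{⊗n}`**
(CVZ Thm. 3.29 ⊇ with Lemma 3.20: the triple is the normalised weight of a covariant that does not
vanish on the orbit of `x`). [cite: ChristandlVranaZuiddam2023, Thm. 3.30] -/
theorem weightedPartitionEntropy_le_logQuantumFunctional_of_actTensor_ne_zero (hn : 0 < n)
    {θ : Fin 3 → ℝ} (hθ : ∀ j, 0 ≤ θ j) {x : Fin a → Fin b → Fin c → ℂ}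
    {lam mu nu : Nat.Partition n}
    (h : actTensor (wordIsotypicMatrix a n lam) (wordIsotypicMatrix b n mu)
      (wordIsotypicMatrix c n nu) (kroneckerPow x n) ≠ 0) :
    θ 0 * partitionEntropy lam + θ 1 * partitionEntropy mu + θ 2 * partitionEntropy nu ≤
      logQuantumFunctional θ x := by
  obtain ⟨g₁, g₂, g₃, ξ₁, ξ₂, ξ₃, h₁, h₂, h₃, hne⟩ := exists_pairing_triad_ne_zero h
  rw [pairing_triad_wordRep] at hne
  -- the covariant and its properties
  have hf := isLowerSemiInvariant_pairing_kroneckerPow h₁ h₂ h₃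
  have hfc := continuous_pairing_kroneckerPow n ξ₁ ξ₂ ξ₃
  -- the vectors are nonzero, so the shapes fit the alphabets
  have hξ₁ : ξ₁ ≠ 0 := by rintro rfl; simp at hne
  have hξ₂ : ξ₂ ≠ 0 := by rintro rfl; simp at hne
  have hξ₃ : ξ₃ ≠ 0 := by rintro rfl; simp at hne
  have ha := card_parts_le_of_mem_highestWeightSpace_ne_zero h₁ hξ₁
  have hb := card_parts_le_of_mem_highestWeightSpace_ne_zero h₂ hξ₂
  have hc := card_parts_le_of_mem_highestWeightSpace_ne_zero h₃ hξ₃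
  have hsum : ∑ i : Fin a, lam.sortedParts.getD i 0 = n := sum_sortedParts_getD ha
  have hk : 0 < ∑ i : Fin a, lam.sortedParts.getD i 0 := by rw [hsum]; exact hn
  -- the transposed group element
  set g : GL (Fin a) ℂ × GL (Fin b) ℂ × GL (Fin c) ℂ :=
    (Literature.NumberTheory.DiophantineGeometry.transposeGL ℂ g₁,
      Literature.NumberTheory.DiophantineGeometry.transposeGL ℂ g₂,
      Literature.NumberTheory.DiophantineGeometry.transposeGL ℂ g₃) with hg
  have hx : (fun y : Fin a → Fin b → Fin c → ℂ =>
      ∑ u, ∑ v, ∑ w, kroneckerPow y n u v w * triad ξ₁ ξ₂ ξ₃ u v w)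
      (actTensor (g.1 : Matrix (Fin a) (Fin a) ℂ) (g.2.1 : Matrix (Fin b) (Fin b) ℂ)
        (g.2.2 : Matrix (Fin c) (Fin c) ℂ) x) ≠ 0 := by
    simpa [hg, Literature.NumberTheory.DiophantineGeometry.coe_transposeGL] using hne
  have key := hf.weightedEntropy_le_logQuantumFunctional_of_orbit hfc hk g hx hθ
  rw [hsum, shannonEntropy_sortedParts_getD ha, shannonEntropy_sortedParts_getD hb,
    shannonEntropy_sortedParts_getD hc] at key
  exact key

end Covariant

/-! ## §5 Assembly: `E^θ ≤ E_θ`, and the discharge of `_upper_eq_lower` -/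

section Assembly

variable {a b c n : ℕ}

/-- **Completing an admissible triple**: from `(M₁ ⊗ M₂ ⊗ M₃) X ≠ 0` with `Mⱼ = P_{λ⁽ʲ⁾}` where
`θⱼ ≠ 0` and `Mⱼ = 1` where `θⱼ = 0`, produce a full triple of isotypic projectors not killing
`X`, agreeing with `λ` on the legs with `θⱼ ≠ 0` (`1 = ∑_ν P_ν`). [folklore] -/
theorem exists_full_triple (θ : Fin 3 → ℝ) (lam : Fin 3 → Nat.Partition n)
    {X : Word a n → Word b n → Word c n → ℂ}
    (h : actTensor (if θ 0 = 0 then 1 else wordIsotypicMatrix a n (lam 0))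
      (if θ 1 = 0 then 1 else wordIsotypicMatrix b n (lam 1))
      (if θ 2 = 0 then 1 else wordIsotypicMatrix c n (lam 2)) X ≠ 0) :
    ∃ lam' : Fin 3 → Nat.Partition n, (∀ j, θ j ≠ 0 → lam' j = lam j) ∧
      actTensor (wordIsotypicMatrix a n (lam' 0)) (wordIsotypicMatrix b n (lam' 1))
        (wordIsotypicMatrix c n (lam' 2)) X ≠ 0 := by
  classical
  -- leg 1
  obtain ⟨l₀, hl₀, h0⟩ : ∃ l₀ : Nat.Partition n, (θ 0 ≠ 0 → l₀ = lam 0) ∧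
      actTensor (wordIsotypicMatrix a n l₀) (if θ 1 = 0 then 1 else wordIsotypicMatrix b n (lam 1))
        (if θ 2 = 0 then 1 else wordIsotypicMatrix c n (lam 2)) X ≠ 0 := by
    by_cases h0 : θ 0 = 0
    · rw [if_pos h0, ← sum_wordIsotypicMatrix a n, actTensor_sum_fst] at h
      obtain ⟨l₀, -, hl₀⟩ := Finset.exists_ne_zero_of_sum_ne_zero h
      exact ⟨l₀, fun h' => absurd h0 h', hl₀⟩
    · rw [if_neg h0] at h
      exact ⟨lam 0, fun _ => rfl, h⟩
  -- leg 2
  obtain ⟨l₁, hl₁, h1⟩ : ∃ l₁ : Nat.Partition n, (θ 1 ≠ 0 → l₁ = lam 1) ∧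
      actTensor (wordIsotypicMatrix a n l₀) (wordIsotypicMatrix b n l₁)
        (if θ 2 = 0 then 1 else wordIsotypicMatrix c n (lam 2)) X ≠ 0 := by
    by_cases h1 : θ 1 = 0
    · rw [if_pos h1, ← sum_wordIsotypicMatrix b n, actTensor_sum_snd] at h0
      obtain ⟨l₁, -, hl₁⟩ := Finset.exists_ne_zero_of_sum_ne_zero h0
      exact ⟨l₁, fun h' => absurd h1 h', hl₁⟩
    · rw [if_neg h1] at h0
      exact ⟨lam 1, fun _ => rfl, h0⟩
  -- leg 3
  obtain ⟨l₂, hl₂, h2⟩ : ∃ l₂ : Nat.Partition n, (θ 2 ≠ 0 → l₂ = lam 2) ∧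
      actTensor (wordIsotypicMatrix a n l₀) (wordIsotypicMatrix b n l₁)
        (wordIsotypicMatrix c n l₂) X ≠ 0 := by
    by_cases h2 : θ 2 = 0
    · rw [if_pos h2, ← sum_wordIsotypicMatrix c n, actTensor_sum_thd] at h1
      obtain ⟨l₂, -, hl₂⟩ := Finset.exists_ne_zero_of_sum_ne_zero h1
      exact ⟨l₂, fun h' => absurd h2 h', hl₂⟩
    · rw [if_neg h2] at h1
      exact ⟨lam 2, fun _ => rfl, h1⟩
  refine ⟨![l₀, l₁, l₂], fun j hj => ?_, h2⟩
  fin_cases j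
  · exact hl₀ hj
  · exact hl₁ hj
  · exact hl₂ hj

/-- **Admissible triples are bounded by the lower functional** (alphabets `Fin a`): if
`(λ⁽ʲ⁾ ⊢ n)ⱼ` is admissible for `x` in the sense of Def. 3.3 then
`∑ θⱼ H(λ̄⁽ʲ⁾) ≤ E_θ(x)` (`θ ≥ 0`). [cite: ChristandlVranaZuiddam2023, Thm. 3.30] -/
theorem weightedPartitionEntropy_le_logQuantumFunctional_of_upperAdmissible_fin (hn : 0 < n)
    {θ : Fin 3 → ℝ} (hθ : ∀ j, 0 ≤ θ j) {x : Fin a → Fin b → Fin c → ℂ} {lam : Fin 3 → Nat.Partition n}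
    (hadm : UpperAdmissible θ x n lam) : weightedPartitionEntropy θ lam ≤ logQuantumFunctional θ x := by
  classical
  obtain ⟨z, hz, heq⟩ := upperProjection_eq_smul_actTensor θ lam (kroneckerPow x n)
  have hM : actTensor (if θ 0 = 0 then 1 else wordIsotypicMatrix a n (lam 0))
      (if θ 1 = 0 then 1 else wordIsotypicMatrix b n (lam 1))
      (if θ 2 = 0 then 1 else wordIsotypicMatrix c n (lam 2)) (kroneckerPow x n) ≠ 0 := by
    intro h0
    apply hadm
    rw [heq, h0, smul_zero]
  obtain ⟨lam', hlam', hne⟩ := exists_full_triple θ lam hM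
  have key := weightedPartitionEntropy_le_logQuantumFunctional_of_actTensor_ne_zero hn hθ hne
  -- the objective does not see the legs with `θⱼ = 0`
  have hw : weightedPartitionEntropy θ lam =
      θ 0 * partitionEntropy (lam' 0) + θ 1 * partitionEntropy (lam' 1) +
        θ 2 * partitionEntropy (lam' 2) := by
    unfold weightedPartitionEntropy
    have t : ∀ j, θ j * partitionEntropy (lam j) = θ j * partitionEntropy (lam' j) := by
      intro j
      by_cases hj : θ j = 0
      · rw [hj, zero_mul, zero_mul]
      · rw [hlam' j hj]
    rw [t 0, t 1, t 2]
  rw [hw]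
  exact key

/-- **`E^θ(x) ≤ E_θ(x)`** on alphabets `Fin a, Fin b, Fin c` (CVZ Thm. 3.30, via Thm. 3.29).
[cite: ChristandlVranaZuiddam2023, Thm. 3.30] -/
theorem upperLogQuantumFunctional_le_logQuantumFunctional_fin {θ : Fin 3 → ℝ} (hθ : ∀ j, 0 ≤ θ j)
    (x : Fin a → Fin b → Fin c → ℂ) : upperLogQuantumFunctional θ x ≤ logQuantumFunctional θ x := by
  refine Real.sSup_le ?_ (logQuantumFunctional_nonneg hθ x)
  rintro _ ⟨n, lam, hn, hadm, rfl⟩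
  exact weightedPartitionEntropy_le_logQuantumFunctional_of_upperAdmissible_fin hn hθ hadm

universe u

variable {ι κ μ : Type u} [Fintype ι] [Fintype κ] [Fintype μ] [DecidableEq ι] [DecidableEq κ]
  [DecidableEq μ]

omit [Fintype ι] [Fintype κ] [Fintype μ] in
/-- `E_θ(0) = 0` (every term of the supremum is `H_θ(0) = 0`). [folklore] -/
theorem logQuantumFunctional_zero' [Fintype ι] [Fintype κ] [Fintype μ] (θ : Fin 3 → ℝ) :
    logQuantumFunctional θ (0 : ι → κ → μ → ℂ) = 0 := by
  simp only [logQuantumFunctional, actTensor_zero, quantumEntropy_zero, ciSup_const]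

/-- `E_θ` is invariant under relabelling the bases. [cite: ChristandlVranaZuiddam2023, Rem. 3.17] -/
theorem logQuantumFunctional_actTensor_relabel {a' b' c' : ℕ} {θ : Fin 3 → ℝ} (hθ : ∀ j, 0 ≤ θ j)
    (e₁ : ι ≃ Fin a') (e₂ : κ ≃ Fin b') (e₃ : μ ≃ Fin c') (t : ι → κ → μ → ℂ) :
    logQuantumFunctional θ (actTensor ((1 : Matrix ι ι ℂ).submatrix (⇑e₁.symm) id)
      ((1 : Matrix κ κ ℂ).submatrix (⇑e₂.symm) id) ((1 : Matrix μ μ ℂ).submatrix (⇑e₃.symm) id) t) =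
      logQuantumFunctional θ t := by
  by_cases ht : t = 0
  · subst ht
    rw [actTensor_zero, logQuantumFunctional_zero', logQuantumFunctional_zero']
  have hback : actTensor ((1 : Matrix ι ι ℂ).submatrix (⇑e₁.symm) id)ᴴ
      ((1 : Matrix κ κ ℂ).submatrix (⇑e₂.symm) id)ᴴ ((1 : Matrix μ μ ℂ).submatrix (⇑e₃.symm) id)ᴴ
      (actTensor ((1 : Matrix ι ι ℂ).submatrix (⇑e₁.symm) id)
        ((1 : Matrix κ κ ℂ).submatrix (⇑e₂.symm) id) ((1 : Matrix μ μ ℂ).submatrix (⇑e₃.symm) id) t) = t := by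
    rw [actTensor_actTensor, conjTranspose_relabel_mul_self, conjTranspose_relabel_mul_self,
      conjTranspose_relabel_mul_self, actTensor_one]
  have ht' : actTensor ((1 : Matrix ι ι ℂ).submatrix (⇑e₁.symm) id)
      ((1 : Matrix κ κ ℂ).submatrix (⇑e₂.symm) id) ((1 : Matrix μ μ ℂ).submatrix (⇑e₃.symm) id) t ≠ 0 := by
    intro h0
    apply ht
    rw [← hback, h0, actTensor_zero]
  refine le_antisymm (logQuantumFunctional_actTensor_le hθ t _ _ _ ht') ?_
  have h := logQuantumFunctional_actTensor_le hθ _ _ _ _ (hback.symm ▸ ht)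
  rwa [hback] at h

/-- **`E^θ(t) ≤ E_θ(t)`** for every complex 3-tensor on finite index types and `θ ≥ 0`
(CVZ Thm. 3.30 with Thm. 3.29; relabel to alphabets `Fin a`). [cite: ChristandlVranaZuiddam2023, Thm. 3.30] -/
theorem upperLogQuantumFunctional_le_logQuantumFunctional {θ : Fin 3 → ℝ} (hθ : ∀ j, 0 ≤ θ j)
    (t : ι → κ → μ → ℂ) : upperLogQuantumFunctional θ t ≤ logQuantumFunctional θ t := by
  set e₁ := Fintype.equivFin ι
  set e₂ := Fintype.equivFin κ
  set e₃ := Fintype.equivFin μ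
  set t' := actTensor ((1 : Matrix ι ι ℂ).submatrix (⇑e₁.symm) id)
    ((1 : Matrix κ κ ℂ).submatrix (⇑e₂.symm) id) ((1 : Matrix μ μ ℂ).submatrix (⇑e₃.symm) id) t with ht'
  refine Real.sSup_le ?_ (logQuantumFunctional_nonneg hθ t)
  rintro _ ⟨n, lam, hn, hadm, rfl⟩
  have hadm' : UpperAdmissible θ t' n lam := (upperAdmissible_actTensor_relabel_iff e₁ e₂ e₃ θ t lam).2 hadm
  have h := weightedPartitionEntropy_le_logQuantumFunctional_of_upperAdmissible_fin hn hθ hadm'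
  rwa [ht', logQuantumFunctional_actTensor_relabel hθ] at h

/-- **CVZ Theorem 3.30, `E^θ = E_θ`**, for every `θ ∈ P([3])` and every complex 3-tensor on finite
index types (no non-vanishing hypothesis is needed with the tree's conventions
`E^θ(0) = E_θ(0) = 0`). [cite: ChristandlVranaZuiddam2023, Thm. 3.30] -/
theorem upperLogQuantumFunctional_eq_logQuantumFunctional {θ : Fin 3 → ℝ}
    (hθ : θ ∈ stdSimplex ℝ (Fin 3)) (t : ι → κ → μ → ℂ) :
    upperLogQuantumFunctional θ t = logQuantumFunctional θ t :=
  le_antisymm (upperLogQuantumFunctional_le_logQuantumFunctional hθ.1 t)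
    (logQuantumFunctional_le_upperLogQuantumFunctional hθ t)

/-- **Discharge of the named fact `ChristandlVranaZuiddam2023_upper_eq_lower` (CVZ Thm. 3.30).**
[cite: ChristandlVranaZuiddam2023, Thm. 3.30] -/
theorem ChristandlVranaZuiddam2023_upper_eq_lower_holds : ChristandlVranaZuiddam2023_upper_eq_lower.{u} :=
  fun _θ hθ _ι _κ _μ _ _ _ _ _ _ t _ => upperLogQuantumFunctional_eq_logQuantumFunctional hθ t

end Assembly

end Literature.Computability.AlgebraicComplexity

end
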